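import Literature.Computability.Complexity.ShenProtocolGame
import Literature.Computability.Complexity.ShenGameParsers
import Literature.Computability.Complexity.TQBFShenSchedule
import HarnessLib

/-!
# The `IP = PSPACE` referee over the naturals: Arthur's arithmetic mod `p`, and its agreement with the game

The Shamir–Shen game (`ShenProtocolGame.lean`) is played over the abstract field `𝔽_p = ZMod p`; the
polynomial-time referee that decides its histories (next file) computes with binary numerals. This
file is the machine-free SPECIFICATION of that referee — every quantity Arthur computes in Arora–Barak's
§8.3.3, written as a function on natural numbers reduced mod `p` — and the proof that it decides
exactly `ShenGame.accepts` for the schedule of a prenex formula (`TQBFShenSchedule.lean`) with the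
parsers of `ShenGameParsers.lean`:

* `ShenRef.hornerMod q r cs` — Horner evaluation mod `q` of a coefficient list; `cast_hornerMod`:
  it is the value of `Σ cᵢ Xⁱ` at `r` in `ZMod q`; `coeffsOf`, `cast_hornerMod_coeffsOf` (the reading
  `ShenGame.polyOfBits` of Merlin's move, evaluated at `s(0)`, `s(1)`, `s(a)`);
* `ShenRef.Tok`, `tokens φ` (prefix order), `rpnStep` / `natVal` — reverse-Polish evaluation of the
  arithmetized matrix `P_φ` mod `q` with a value stack ("the verifier can evaluate `g(b₁, …, bₙ)` in
  polynomial time", AB §8.3.2); `foldl_rpnStep_reverse_tokens`, `cast_natVal` (`= P_φ(v)` in `ZMod p`);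
* `ShenRef.opOfRound quants i` — which operator (`0 = ∀`, `1 = ∃`, `2 = L`) on which variable round
  `i` treats, by index arithmetic, and `code_ops_getElem`: it is `(TQBFShen.ops ψ)[i]`;
* `ShenRef.checkNat`, `natRoundStep`, `natAccepts` — Arthur's round and verdict over `ℕ`, and
  **`ShenRef.natAccepts_eq_accepts`**: on every history they compute `ShenGame.accepts` for
  `TQBFShen.ops ψ`, `TQBFShen.matrixPoly ψ`, `polyOfBits p β d`, `fieldOfBits p`, initial point `0`,
  initial claim `1` (the simulation invariant `ShenRef.Rel`: equal round counter and flag, residues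
  below `p`, point and claim equal after casting).

All proved; no machines yet, no named facts.

## References

* S. Arora, B. Barak, *Computational Complexity: A Modern Approach*, CUP 2009, §8.3.2–8.3.3 (what the
  verifier computes: `s(0)`, `s(1)`, `s(a)`, the three checks, `g(b₁,…,bₙ)`), PDF pp. 192–195.
-/

noncomputable section

namespace Literature.Computability.Complexity

open MvPolynomial QBFArith Finset Literature.Barriers.QuantumAdvantage

open scoped Classical

namespace ShenRef

/-! ### Horner evaluation mod `q` -/

/-- **Horner evaluation mod `q`** of the polynomial with coefficient list `cs` (constant term first) at
`r`: a left fold over the reversed list. [cite: AroraBarakCC2009, §8.3.2 ("the verifier can evaluate … in polynomial time")] -/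
def hornerMod (q r : ℕ) (cs : List ℕ) : ℕ :=
  cs.reverse.foldl (fun acc c => (c + r * acc) % q) 0

/-- The Horner value is a residue. [folklore] -/
theorem hornerMod_lt {q : ℕ} (hq : 0 < q) (r : ℕ) (cs : List ℕ) : hornerMod q r cs < q := by
  unfold hornerMod
  rw [List.foldl_reverse]
  cases cs with
  | nil => simpa using hq
  | cons c cs => simp only [List.foldr_cons]; exact Nat.mod_lt _ hq

/-- The polynomial over `ZMod q` with the given natural coefficients. [folklore] -/
def polyOfCoeffs (q : ℕ) (cs : List ℕ) : Polynomial (ZMod q) :=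
  ∑ i ∈ range cs.length, Polynomial.C (cs.getD i 0 : ZMod q) * Polynomial.X ^ i

/-- `polyOfCoeffs` of a cons: `C c + X · (rest)`. [folklore] -/
theorem polyOfCoeffs_cons (q c : ℕ) (cs : List ℕ) :
    polyOfCoeffs q (c :: cs) = Polynomial.C (c : ZMod q) + Polynomial.X * polyOfCoeffs q cs := by
  unfold polyOfCoeffs
  rw [List.length_cons, sum_range_succ', mul_sum]
  simp only [List.getD_cons_succ, List.getD_cons_zero, pow_zero, mul_one, pow_succ]
  rw [add_comm]
  congr 1
  exact sum_congr rfl fun i _ => by ring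

/-- **Horner computes the value**: `hornerMod q r cs = (Σ cᵢ Xⁱ)(r)` in `ZMod q`. [folklore] -/
theorem cast_hornerMod (q r : ℕ) (cs : List ℕ) :
    (hornerMod q r cs : ZMod q) = (polyOfCoeffs q cs).eval (r : ZMod q) := by
  unfold hornerMod
  rw [List.foldl_reverse]
  induction cs with
  | nil => simp [polyOfCoeffs]
  | cons c cs ih =>
    rw [List.foldr_cons, ZMod.natCast_mod, Nat.cast_add, Nat.cast_mul, ih, polyOfCoeffs_cons]
    simp

/-- **The coefficients Arthur reads off Merlin's move**: block `i` of width `β`, as a residue, for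
`i ≤ d`. [cite: AroraBarakCC2009, §8.3.3] -/
def coeffsOf (q β d : ℕ) (y : List Bool) : List ℕ :=
  (List.range (d + 1)).map fun i => bitsToNat (block β i y) % q

/-- The coefficient list realises `ShenGame.polyOfBits`. [folklore] -/
theorem polyOfCoeffs_coeffsOf (q β d : ℕ) (y : List Bool) :
    polyOfCoeffs q (coeffsOf q β d y) = ShenGame.polyOfBits q β d y := by
  unfold polyOfCoeffs coeffsOf ShenGame.polyOfBits
  rw [List.length_map, List.length_range]
  refine sum_congr rfl fun i hi => ?_
  congr 2
  rw [List.getD_eq_getElem?_getD, List.getElem?_map, List.getElem?_range (mem_range.1 hi)]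
  simp

/-- **`s(r)` as Arthur computes it**: Horner mod `q` on the read coefficients is the value of Merlin's
polynomial. [cite: AroraBarakCC2009, §8.3.3] -/
theorem cast_hornerMod_coeffsOf (q β d r : ℕ) (y : List Bool) :
    (hornerMod q r (coeffsOf q β d y) : ZMod q) = (ShenGame.polyOfBits q β d y).eval (r : ZMod q) := by
  rw [cast_hornerMod, polyOfCoeffs_coeffsOf]

/-! ### Reverse-Polish evaluation of the arithmetized matrix -/

/-- Tokens of the prefix code of a formula. [folklore] -/
inductive Tok
  | var (n : ℕ)
  | cst (b : Bool)
  | neg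
  | conj
  | disj
  deriving DecidableEq

/-- The token list of a formula, in prefix (Polish) order — the order of `PropForm.code`. [folklore] -/
def tokens : PropForm ℕ → List Tok
  | .var n => [.var n]
  | .const b => [.cst b]
  | .neg φ => .neg :: tokens φ
  | .conj φ ψ => .conj :: (tokens φ ++ tokens ψ)
  | .disj φ ψ => .disj :: (tokens φ ++ tokens ψ)

/-- `1 - a` mod `q` on residues. [folklore] -/
def oneSub (q a : ℕ) : ℕ := (1 + q - a) % q

/-- **One step of the reverse-Polish evaluation** (tokens are fed in REVERSE prefix order): push the
value of a leaf, or combine the top of the stack by the arithmetized connective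
(`¬ ↦ 1 - ·`, `∧ ↦ ·`, `∨ ↦ 1 - (1 - ·)(1 - ·)`), all mod `q`. [cite: AroraBarakCC2009, §8.3.1] -/
def rpnStep (q : ℕ) (vals : List ℕ) (st : List ℕ) : Tok → List ℕ
  | .var n => (vals.getD n 0 % q) :: st
  | .cst b => (b.toNat % q) :: st
  | .neg => match st with
    | a :: st' => oneSub q a :: st'
    | [] => []
  | .conj => match st with
    | a :: b :: st' => (a * b % q) :: st'
    | _ => []
  | .disj => match st with
    | a :: b :: st' => oneSub q (oneSub q a * oneSub q b % q) :: st'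
    | _ => []

/-- **The value of `P_φ` mod `q`** at the point `vals` (variable `n` reads `vals[n]`, default `0`), by the
same recursion the stack machine performs. [cite: AroraBarakCC2009, §8.3.1] -/
def natVal (q : ℕ) (vals : List ℕ) : PropForm ℕ → ℕ
  | .var n => vals.getD n 0 % q
  | .const b => b.toNat % q
  | .neg φ => oneSub q (natVal q vals φ)
  | .conj φ ψ => natVal q vals φ * natVal q vals ψ % q
  | .disj φ ψ => oneSub q (oneSub q (natVal q vals φ) * oneSub q (natVal q vals ψ) % q)

/-- **The stack machine evaluates the formula**: feeding the reversed tokens of `φ` pushes `natVal φ`.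
[folklore] -/
theorem foldl_rpnStep_reverse_tokens (q : ℕ) (vals : List ℕ) :
    ∀ (φ : PropForm ℕ) (rest : List Tok) (st : List ℕ),
      ((tokens φ).reverse ++ rest).foldl (rpnStep q vals) st = rest.foldl (rpnStep q vals) (natVal q vals φ :: st)
  | .var n, rest, st => by simp [tokens, rpnStep, natVal]
  | .const b, rest, st => by simp [tokens, rpnStep, natVal]
  | .neg φ, rest, st => by
    rw [tokens, List.reverse_cons, List.append_assoc, foldl_rpnStep_reverse_tokens q vals φ]
    simp [rpnStep, natVal]
  | .conj φ ψ, rest, st => by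
    rw [tokens, List.reverse_cons, List.reverse_append, List.append_assoc, List.append_assoc,
      foldl_rpnStep_reverse_tokens q vals ψ, foldl_rpnStep_reverse_tokens q vals φ]
    simp [rpnStep, natVal]
  | .disj φ ψ, rest, st => by
    rw [tokens, List.reverse_cons, List.reverse_append, List.append_assoc, List.append_assoc,
      foldl_rpnStep_reverse_tokens q vals ψ, foldl_rpnStep_reverse_tokens q vals φ]
    simp [rpnStep, natVal]

/-- `natVal` is a residue. [folklore] -/
theorem natVal_lt {q : ℕ} (hq : 0 < q) (vals : List ℕ) : ∀ φ : PropForm ℕ, natVal q vals φ < q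
  | .var _ => Nat.mod_lt _ hq
  | .const _ => Nat.mod_lt _ hq
  | .neg _ => Nat.mod_lt _ hq
  | .conj _ _ => Nat.mod_lt _ hq
  | .disj _ _ => Nat.mod_lt _ hq

/-- `oneSub` is `1 - ·` on residues. [folklore] -/
theorem cast_oneSub {q a : ℕ} (ha : a ≤ q) : (oneSub q a : ZMod q) = 1 - (a : ZMod q) := by
  unfold oneSub
  rw [ZMod.natCast_mod, Nat.cast_sub (by omega), Nat.cast_add, Nat.cast_one, ZMod.natCast_self, add_zero]

/-- **The stack value is `P_φ(v)` in `ZMod q`** (`v_n = vals[n]`; `vals` no longer than `N`, so that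
variables `≥ N` read `0` on both sides). [cite: AroraBarakCC2009, §8.3.1] -/
theorem cast_natVal {q : ℕ} (hq : 0 < q) {N : ℕ} (vals : List ℕ) (hlen : vals.length ≤ N) :
    ∀ φ : PropForm ℕ, (natVal q vals φ : ZMod q) =
      MvPolynomial.eval (fun i : Fin N => (vals.getD i 0 : ZMod q)) (PropForm.arith N φ)
  | .var n => by
    unfold natVal PropForm.arith
    by_cases hn : n < N
    · rw [dif_pos hn, MvPolynomial.eval_X, ZMod.natCast_mod]
    · rw [dif_neg hn, map_zero, ZMod.natCast_mod, List.getD_eq_default _ _ (by omega), Nat.cast_zero]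
  | .const b => by cases b <;> simp [natVal, PropForm.arith]
  | .neg φ => by
    rw [natVal, PropForm.arith, map_sub, map_one, cast_oneSub (natVal_lt hq vals φ).le, cast_natVal hq vals hlen φ]
  | .conj φ ψ => by
    rw [natVal, PropForm.arith, map_mul, ZMod.natCast_mod, Nat.cast_mul, cast_natVal hq vals hlen φ,
      cast_natVal hq vals hlen ψ]
  | .disj φ ψ => by
    rw [natVal, PropForm.arith, map_sub, map_one, map_mul, map_sub, map_one, map_sub, map_one,
      cast_oneSub (Nat.mod_lt _ hq).le, ZMod.natCast_mod, Nat.cast_mul,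
      cast_oneSub (natVal_lt hq vals φ).le, cast_oneSub (natVal_lt hq vals ψ).le,
      cast_natVal hq vals hlen φ, cast_natVal hq vals hlen ψ]

/-! ### The operator of a round -/

/-- Numeric code of an operator: kind (`0 = ∀`, `1 = ∃`, `2 = L`) and variable. [folklore] -/
def _root_.Literature.Computability.Complexity.QBFArith.Op.code {N : ℕ} : Op N → ℕ × ℕ
  | .all j => (0, j)
  | .ex j => (1, j)
  | .lin j => (2, j)

/-- **The operator treated in round `i`**, by index arithmetic on the schedule
`[Q₀ L₀ ⋯ L_{N-1}] [Q₁ L₀ ⋯ L_{N-1}] ⋯ [Q_{N-1} L₀ ⋯ L_{N-1}] [L₀ ⋯ L_{N-1}]`: blocks of length `N + 1`,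
then the innermost sweep. [cite: AroraBarakCC2009, §8.3.3] -/
def opOfRound (quants : List Bool) (i : ℕ) : ℕ × ℕ :=
  if decide (i < quants.length * (quants.length + 1)) then
    if i % (quants.length + 1) == 0 then
      (if quants.getD (i / (quants.length + 1)) false then 0 else 1, i / (quants.length + 1))
    else (2, i % (quants.length + 1) - 1)
  else (2, i - quants.length * (quants.length + 1))

/-- Entries of a sweep. [folklore] -/
theorem getElem?_sweep {N o : ℕ} (ho : o < N) : (sweep N)[o]? = some (Op.lin ⟨o, ho⟩) := by
  have hlen : o < (List.finRange N).length := by simpa using ho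
  rw [sweep, List.getElem?_map, List.getElem?_eq_getElem hlen, List.getElem_finRange]
  rfl

/-- Entries of a block schedule built from `qlistFrom`: position `b·(N+1) + o` of the schedule of the
prefix from `k` on is the quantifier of variable `k + b` if `o = 0`, else `L_{o-1}`. [folklore] -/
theorem getElem?_schedule_qlistFrom {N : ℕ} :
    ∀ (qs : List Bool) (k b o : ℕ) (hk : k + qs.length ≤ N) (hb : b < qs.length) (ho : o ≤ N),
      (schedule (TQBFShen.qlistFrom N k qs))[b * (N + 1) + o]? =
        some (if _ho0 : o = 0 then (if qs.getD b false then Op.all ⟨k + b, by omega⟩ else Op.ex ⟨k + b, by omega⟩)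
          else Op.lin ⟨o - 1, by omega⟩)
  | [], k, b, o, _, hb, _ => absurd hb (Nat.not_lt_zero _)
  | q :: qs, k, b, o, hk, hb, ho => by
    have hkN : k < N := by simp only [List.length_cons] at hk; omega
    rw [TQBFShen.qlistFrom, dif_pos hkN]
    simp only [schedule, List.map_cons, List.flatten_cons]
    have hlen : (qblock (quantOp (q, (⟨k, hkN⟩ : Fin N)))).length = N + 1 := by
      rw [qblock, List.length_cons, sweep, List.length_map, List.length_finRange]
    cases b with
    | zero =>
      rw [Nat.zero_mul, Nat.zero_add, List.getElem?_append_left (by rw [hlen]; omega)]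
      by_cases ho0 : o = 0
      · subst ho0
        simp only [qblock, List.getElem?_cons_zero, dif_pos, List.getD_cons_zero, Nat.add_zero]
        cases q <;> rfl
      · obtain ⟨o', rfl⟩ := Nat.exists_eq_succ_of_ne_zero ho0
        rw [qblock, List.getElem?_cons_succ, getElem?_sweep (by omega), dif_neg ho0]
        rfl
    | succ b =>
      have hshift : (b + 1) * (N + 1) + o = (qblock (quantOp (q, (⟨k, hkN⟩ : Fin N)))).length + (b * (N + 1) + o) := by
        rw [hlen]; ring
      rw [hshift, List.getElem?_append_right (Nat.le_add_right _ _), Nat.add_sub_cancel_left]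
      have ih := getElem?_schedule_qlistFrom qs (k + 1) b o (by simp only [List.length_cons] at hk; omega)
        (by simp only [List.length_cons] at hb; omega) ho
      rw [show (List.map (fun q => qblock (quantOp q)) (TQBFShen.qlistFrom N (k + 1) qs)).flatten =
        schedule (TQBFShen.qlistFrom N (k + 1) qs) from rfl, ih]
      simp only [List.getD_cons_succ, show k + 1 + b = k + (b + 1) by ring]

/-- **`opOfRound` reads the schedule**: for `i < T`, the code of `(TQBFShen.ops ψ)[i]` is
`opOfRound ψ.quants i`. [cite: AroraBarakCC2009, §8.3.3] -/
theorem code_ops_getElem (ψ : PrenexQBF) {i : ℕ} (hi : i < (TQBFShen.ops ψ).length) :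
    ((TQBFShen.ops ψ)[i]).code = opOfRound ψ.quants i := by
  have hT : (TQBFShen.ops ψ).length = ψ.quants.length * (ψ.quants.length + 1) + ψ.quants.length :=
    TQBFShen.length_ops ψ
  have hsched : (schedule (TQBFShen.qlistFrom ψ.quants.length 0 ψ.quants)).length =
      ψ.quants.length * (ψ.quants.length + 1) := by
    rw [TQBFShen.length_schedule, TQBFShen.length_qlistFrom _ _ 0 (by omega)]
  apply Option.some_injective
  rw [← Option.map_some (f := Op.code), ← List.getElem?_eq_getElem hi]
  unfold opOfRound
  rw [hT] at hi
  generalize hM : ψ.quants.length * (ψ.quants.length + 1) = M at hi hsched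
  by_cases hlt : i < M
  · rw [if_pos (decide_eq_true hlt), TQBFShen.ops, List.getElem?_append_left (by rw [hsched]; exact hlt)]
    have hNpos : 0 < ψ.quants.length := Nat.pos_of_ne_zero fun h => by rw [h] at hM; omega
    have hi' : i = i / (ψ.quants.length + 1) * (ψ.quants.length + 1) + i % (ψ.quants.length + 1) := by
      rw [Nat.mul_comm]; exact (Nat.div_add_mod i (ψ.quants.length + 1)).symm
    have hbN : i / (ψ.quants.length + 1) < ψ.quants.length :=
      Nat.div_lt_of_lt_mul (by rw [Nat.mul_comm, hM]; exact hlt)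
    have hoN : i % (ψ.quants.length + 1) ≤ ψ.quants.length := Nat.lt_succ_iff.1 (Nat.mod_lt _ (Nat.succ_pos _))
    conv_lhs => rw [hi']
    rw [getElem?_schedule_qlistFrom ψ.quants 0 _ _ (by omega) hbN hoN, Option.map_some]
    by_cases ho0 : i % (ψ.quants.length + 1) = 0
    · rw [dif_pos ho0, if_pos (show (i % (ψ.quants.length + 1) == 0) = true by rw [ho0]; rfl)]
      cases ψ.quants.getD (i / (ψ.quants.length + 1)) false <;> simp [Op.code]
    · rw [dif_neg ho0, if_neg (show ¬ ((i % (ψ.quants.length + 1) == 0) = true) by rw [beq_iff_eq]; exact ho0)]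
      rfl
  · rw [if_neg (by rw [decide_eq_true_eq]; exact hlt), TQBFShen.ops, List.getElem?_append_right (by rw [hsched]; omega),
      hsched, getElem?_sweep (by omega), Option.map_some]
    rfl

/-! ### Arthur's round and verdict over `ℕ` -/

/-- **The consistency check, over `ℕ`**: kind `0` (`∀`): `s(0)·s(1)`; kind `1` (`∃`):
`1 - (1 - s(0))(1 - s(1))`; kind `2` (`L_{X_j}`): `(1 - v_j)·s(0) + v_j·s(1)` — all mod `q`.
[cite: AroraBarakCC2009, §8.3.3 (Cases 1–3)] -/
def checkNat (q kind vj s0 s1 : ℕ) : ℕ :=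
  if kind == 0 then s0 * s1 % q
  else if kind == 1 then oneSub q (oneSub q s0 * oneSub q s1 % q)
  else (oneSub q vj * s0 + vj * s1) % q

/-- `checkNat` is a residue. [folklore] -/
theorem checkNat_lt {q : ℕ} (hq : 0 < q) (kind vj s0 s1 : ℕ) : checkNat q kind vj s0 s1 < q := by
  unfold checkNat oneSub; split_ifs <;> exact Nat.mod_lt _ hq

/-- **`checkNat` computes `QBFArith.checkVal`** in `ZMod q`, for the operator with the given code.
[cite: AroraBarakCC2009, §8.3.3] -/
theorem cast_checkNat {q : ℕ} (hq : 0 < q) {N : ℕ} (op : Op N) (v : Fin N → ZMod q) {vj s0 s1 : ℕ}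
    (s : Polynomial (ZMod q)) (hvj : vj < q) (hv : (vj : ZMod q) = v op.var) (hs0lt : s0 < q) (hs1lt : s1 < q)
    (hs0 : (s0 : ZMod q) = s.eval 0) (hs1 : (s1 : ZMod q) = s.eval 1) :
    (checkNat q op.code.1 vj s0 s1 : ZMod q) = checkVal op v s := by
  cases op with
  | all j =>
    have h : checkNat q (Op.all j).code.1 vj s0 s1 = s0 * s1 % q := rfl
    rw [h, checkVal, ZMod.natCast_mod, Nat.cast_mul, hs0, hs1]
  | ex j =>
    have h : checkNat q (Op.ex j).code.1 vj s0 s1 = oneSub q (oneSub q s0 * oneSub q s1 % q) := rfl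
    rw [h, checkVal, cast_oneSub (Nat.mod_lt _ hq).le, ZMod.natCast_mod, Nat.cast_mul, cast_oneSub hs0lt.le,
      cast_oneSub hs1lt.le, hs0, hs1]
  | lin j =>
    have h : checkNat q (Op.lin j).code.1 vj s0 s1 = (oneSub q vj * s0 + vj * s1) % q := rfl
    rw [h, checkVal, ZMod.natCast_mod, Nat.cast_add, Nat.cast_mul, Nat.cast_mul, cast_oneSub hvj.le, hs0, hs1, hv]
    rfl

/-- **Arthur's state over `ℕ`**: round counter, the point as a list of `N` residues, the claim, the flag.
[cite: AroraBarakCC2009, §8.3.3] -/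
abbrev NSt : Type := ℕ × List ℕ × ℕ × Bool

/-- **One round, over `ℕ`** (mirror of `ShenGame.roundStep` for the schedule of a prefix `quants`): read the
coefficients and the challenge, check, move the point, record the new claim. Rounds past `T` change
nothing. [cite: AroraBarakCC2009, §8.3.3] -/
def natRoundStep (q β d : ℕ) (quants : List Bool) (st : NSt) (yz : List Bool × List Bool) : NSt :=
  if decide (quants.length * (quants.length + 1) + quants.length ≤ st.1) then st
  else
    (st.1 + 1, st.2.1.set (opOfRound quants st.1).2 (bitsToNat yz.2 % q),
      hornerMod q (bitsToNat yz.2 % q) (coeffsOf q β d yz.1),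
      st.2.2.2 && (checkNat q (opOfRound quants st.1).1 (st.2.1.getD (opOfRound quants st.1).2 0)
        (hornerMod q 0 (coeffsOf q β d yz.1)) (hornerMod q 1 (coeffsOf q β d yz.1)) == st.2.2.1))

/-- **The final check, over `ℕ`**: all checks passed and `P_φ(v) = c` mod `q`. [cite: AroraBarakCC2009, §8.3.3] -/
def natFinal (q : ℕ) (φ : PropForm ℕ) (st : NSt) : Bool :=
  st.2.2.2 && (natVal q st.2.1 φ == st.2.2.1)

/-- The initial state: round `0`, the all-`0` point, claim `1`. [cite: AroraBarakCC2009, §8.3.3] -/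
def natInit (N : ℕ) : NSt := (0, List.replicate N 0, 1, true)

/-- **Arthur's verdict on a history, over `ℕ`** (mirror of `ShenGame.accepts`): `T` rounds on the move
pairs after Arthur's opening move, then the final check. [cite: AroraBarakCC2009, §8.3.3] -/
def natAccepts (q β d : ℕ) (ψ : PrenexQBF) (h : List (List Bool)) : Bool :=
  decide (ψ.quants.length * (ψ.quants.length + 1) + ψ.quants.length ≤ (ShenGame.pairsOf (h.drop 1)).length) &&
    natFinal q ψ.matrix (((ShenGame.pairsOf (h.drop 1)).take (ψ.quants.length * (ψ.quants.length + 1) + ψ.quants.length)).foldl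
      (natRoundStep q β d ψ.quants) (natInit ψ.quants.length))

/-! ### Agreement with the game over `ZMod p` -/

section Sim

variable {p : ℕ} [hp : Fact p.Prime]

/-- The game state read off a natural state. [folklore] -/
def toSt (N : ℕ) (st : NSt) : ShenGame.St (ZMod p) N :=
  ⟨st.1, fun j => (st.2.1.getD j 0 : ZMod p), (st.2.2.1 : ZMod p), st.2.2.2⟩

/-- **The simulation invariant**: the point has `N` residues and the claim is a residue. [folklore] -/
structure Inv (p N : ℕ) (st : NSt) : Prop where
  /-- the point is a list of `N` entries -/
  len : st.2.1.length = N
  /-- the entries are residues -/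
  vals_lt : ∀ x ∈ st.2.1, x < p
  /-- the claim is a residue -/
  c_lt : st.2.2.1 < p

omit hp in
/-- The initial state satisfies the invariant (`p ≥ 2`). [folklore] -/
theorem inv_natInit (N : ℕ) (hp1 : 1 < p) : Inv p N (natInit N) :=
  ⟨List.length_replicate, fun x hx => by simp only [natInit] at hx; rw [List.eq_of_mem_replicate hx]; omega, hp1⟩

/-- The initial state is read as `ShenGame.initSt 0 1`. [folklore] -/
theorem toSt_natInit (N : ℕ) : toSt (p := p) N (natInit N) = ShenGame.initSt (fun _ => 0) 1 := by
  simp only [toSt, natInit, ShenGame.initSt, Nat.cast_one]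
  congr 1
  funext j
  rw [List.getD_eq_getElem?_getD, List.getElem?_replicate]
  split_ifs <;> simp

/-- Residues are equal iff their casts are. [folklore] -/
theorem natCast_inj_of_lt {a b : ℕ} (ha : a < p) (hb : b < p) : ((a : ZMod p) = (b : ZMod p)) ↔ a = b := by
  constructor
  · intro h
    have := congrArg ZMod.val h
    rwa [ZMod.val_cast_of_lt ha, ZMod.val_cast_of_lt hb] at this
  · rintro rfl; rfl

/-- **One round over `ℕ` is one round of the game** (and keeps the invariant).
[cite: AroraBarakCC2009, §8.3.3] -/
theorem toSt_natRoundStep (ψ : PrenexQBF) (β d : ℕ) {st : NSt} (hinv : Inv p ψ.quants.length st)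
    (yz : List Bool × List Bool) :
    toSt ψ.quants.length (natRoundStep p β d ψ.quants st yz) =
        ShenGame.roundStep (TQBFShen.ops ψ) (ShenGame.polyOfBits p β d) (ShenGame.fieldOfBits p)
          (toSt ψ.quants.length st) yz ∧
      Inv p ψ.quants.length (natRoundStep p β d ψ.quants st yz) := by
  have hp0 : 0 < p := hp.out.pos
  have hT := TQBFShen.length_ops ψ
  have hsti : (toSt (p := p) ψ.quants.length st).i = st.1 := rfl
  by_cases hi : ψ.quants.length * (ψ.quants.length + 1) + ψ.quants.length ≤ st.1
  · -- past the schedule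
    have hnat : natRoundStep p β d ψ.quants st yz = st := by rw [natRoundStep, if_pos (decide_eq_true hi)]
    have hnone : (TQBFShen.ops ψ)[(toSt (p := p) ψ.quants.length st).i]? = none :=
      List.getElem?_eq_none (by rw [hT, hsti]; exact hi)
    rw [hnat, ShenGame.roundStep, hnone]
    exact ⟨rfl, hinv⟩
  · push Not at hi
    have hilt : (toSt (p := p) ψ.quants.length st).i < (TQBFShen.ops ψ).length := by rw [hT, hsti]; exact hi
    have hilt' : st.1 < (TQBFShen.ops ψ).length := hilt
    have hnat : natRoundStep p β d ψ.quants st yz =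
        (st.1 + 1, st.2.1.set (opOfRound ψ.quants st.1).2 (bitsToNat yz.2 % p),
          hornerMod p (bitsToNat yz.2 % p) (coeffsOf p β d yz.1),
          st.2.2.2 && (checkNat p (opOfRound ψ.quants st.1).1 (st.2.1.getD (opOfRound ψ.quants st.1).2 0)
            (hornerMod p 0 (coeffsOf p β d yz.1)) (hornerMod p 1 (coeffsOf p β d yz.1)) == st.2.2.1)) := by
      rw [natRoundStep, if_neg (by rw [decide_eq_true_eq, not_le]; exact hi)]
    have hcode : ((TQBFShen.ops ψ)[st.1]'hilt').code = opOfRound ψ.quants st.1 := code_ops_getElem ψ hilt'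
    have hvar : (((TQBFShen.ops ψ)[st.1]'hilt').var : ℕ) = (opOfRound ψ.quants st.1).2 := by
      rw [← hcode]; cases (TQBFShen.ops ψ)[st.1]'hilt' <;> rfl
    have hkind : (opOfRound ψ.quants st.1).1 = ((TQBFShen.ops ψ)[st.1]'hilt').code.1 := by rw [hcode]
    -- the three computed fields agree
    have hv : (fun j : Fin ψ.quants.length => ((st.2.1.set (opOfRound ψ.quants st.1).2 (bitsToNat yz.2 % p)).getD j 0 : ZMod p)) =
        Function.update (fun j : Fin ψ.quants.length => (st.2.1.getD j 0 : ZMod p)) ((TQBFShen.ops ψ)[st.1]'hilt').var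
          (ShenGame.fieldOfBits p yz.2) := by
      funext j'
      by_cases hj : ((TQBFShen.ops ψ)[st.1]'hilt').var = j'
      · subst hj
        rw [Function.update_self, ← hvar, List.getD_eq_getElem?_getD,
          List.getElem?_set_self (by rw [hinv.len]; exact ((TQBFShen.ops ψ)[st.1]'hilt').var.isLt)]
        simp [ShenGame.fieldOfBits]
      · rw [Function.update_of_ne (Ne.symm hj), List.getD_eq_getElem?_getD,
          List.getElem?_set_ne (by rw [← hvar]; exact fun h => hj (Fin.ext h)), ← List.getD_eq_getElem?_getD]
    have hc : (hornerMod p (bitsToNat yz.2 % p) (coeffsOf p β d yz.1) : ZMod p) =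
        (ShenGame.polyOfBits p β d yz.1).eval (ShenGame.fieldOfBits p yz.2) := by
      rw [cast_hornerMod_coeffsOf, ShenGame.fieldOfBits, ZMod.natCast_mod]
    have hvj : st.2.1.getD (opOfRound ψ.quants st.1).2 0 < p := by
      rw [List.getD_eq_getElem?_getD]
      cases h : st.2.1[(opOfRound ψ.quants st.1).2]? with
      | none => simpa using hp0
      | some x => simpa using hinv.vals_lt x (List.mem_of_getElem? h)
    have hcast := cast_checkNat hp0 ((TQBFShen.ops ψ)[st.1]'hilt') (fun j => (st.2.1.getD j 0 : ZMod p))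
      (ShenGame.polyOfBits p β d yz.1) hvj (by rw [hvar]) (hornerMod_lt hp0 _ _) (hornerMod_lt hp0 _ _)
      (by rw [cast_hornerMod_coeffsOf, Nat.cast_zero]) (by rw [cast_hornerMod_coeffsOf, Nat.cast_one])
    refine ⟨?_, ?_⟩
    · rw [hnat, ShenGame.roundStep_of_lt hilt]
      simp only [toSt] at hv hc ⊢
      rw [hv, hc]
      congr 1
      congr 1
      rw [Bool.eq_iff_iff, beq_iff_eq]
      simp only [decide_eq_true_eq]
      rw [← hcast, hkind]
      exact (natCast_inj_of_lt (checkNat_lt hp0 _ _ _ _) hinv.c_lt).symm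
    · rw [hnat]
      refine ⟨by rw [List.length_set]; exact hinv.len, fun x hx => ?_, hornerMod_lt hp0 _ _⟩
      rcases List.mem_or_eq_of_mem_set hx with h | h
      · exact hinv.vals_lt x h
      · rw [h]; exact Nat.mod_lt _ hp0

/-- **Any number of rounds over `ℕ` are the rounds of the game.** [cite: AroraBarakCC2009, §8.3.3] -/
theorem toSt_foldl_natRoundStep (ψ : PrenexQBF) (β d : ℕ) :
    ∀ (prs : List (List Bool × List Bool)) {st : NSt}, Inv p ψ.quants.length st →
      toSt ψ.quants.length (prs.foldl (natRoundStep p β d ψ.quants) st) =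
          ShenGame.stateOf (TQBFShen.ops ψ) (ShenGame.polyOfBits p β d) (ShenGame.fieldOfBits p)
            (toSt ψ.quants.length st) prs ∧
        Inv p ψ.quants.length (prs.foldl (natRoundStep p β d ψ.quants) st)
  | [], st, hinv => ⟨rfl, hinv⟩
  | yz :: prs, st, hinv => by
    obtain ⟨h1, h2⟩ := toSt_natRoundStep ψ β d hinv yz
    rw [List.foldl_cons, ShenGame.stateOf, List.foldl_cons, ← ShenGame.stateOf, ← h1]
    exact toSt_foldl_natRoundStep ψ β d prs h2

/-- **The final check over `ℕ` is the game's final check.** [cite: AroraBarakCC2009, §8.3.3] -/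
theorem natFinal_eq_finalCheck (ψ : PrenexQBF) {st : NSt} (hinv : Inv p ψ.quants.length st) :
    natFinal p ψ.matrix st =
      ShenGame.finalCheck (TQBFShen.matrixPoly ψ : MvPolynomial _ (ZMod p)) (toSt ψ.quants.length st) := by
  have hp0 : 0 < p := hp.out.pos
  rw [natFinal, ShenGame.finalCheck]
  simp only [toSt]
  congr 1
  rw [Bool.eq_iff_iff, beq_iff_eq]
  simp only [decide_eq_true_eq]
  rw [TQBFShen.matrixPoly, ← cast_natVal hp0 st.2.1 hinv.len.le ψ.matrix]
  exact (natCast_inj_of_lt (natVal_lt hp0 _ _) hinv.c_lt).symm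

/-- **Arthur's verdict over `ℕ` is the game's verdict**: `natAccepts` decides `ShenGame.accepts` for the
schedule and matrix polynomial of `ψ`, Merlin's moves read as `polyOfBits p β d`, Arthur's as
`fieldOfBits p`, from the all-`0` point with claim `1`. [cite: AroraBarakCC2009, §8.3.3] -/
theorem natAccepts_eq_accepts (ψ : PrenexQBF) (β d : ℕ) (h : List (List Bool)) :
    natAccepts p β d ψ h =
      ShenGame.accepts (TQBFShen.ops ψ) (TQBFShen.matrixPoly ψ) (ShenGame.polyOfBits p β d) (ShenGame.fieldOfBits p)
        (fun _ => (0 : ZMod p)) 1 h := by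
  have hT := TQBFShen.length_ops ψ
  obtain ⟨h1, h2⟩ := toSt_foldl_natRoundStep (p := p) ψ β d
    ((ShenGame.pairsOf (h.drop 1)).take (ψ.quants.length * (ψ.quants.length + 1) + ψ.quants.length))
    (inv_natInit ψ.quants.length hp.out.one_lt)
  rw [natAccepts, ShenGame.accepts, hT, natFinal_eq_finalCheck ψ h2, h1, toSt_natInit, ShenGame.stateOf]

end Sim

end ShenRef

end Literature.Computability.Complexity

end
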